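import Literature.NumberTheory.EllipticCurves.FineSelmerIsotypicClassGroupCriterion
import Literature.NumberTheory.NumberFields.EquivariantUnramifiedHomClassGroupDecomposition
import Mathlib.NumberTheory.Padics.RingHoms
import HarnessLib

/-!
# DOOR L5: Conjecture A from the `S`-split `E[p]`-part of the class group at ONE finite layer of the
# cyclotomic tower, WITHOUT the local condition (c3) at `p` (Deo–Ray–Sujatha's criterion up the tower;
# Coates–Sujatha 2005 Thm. 3.4 isotypic, `H²`-free) — PROVED, general form

Topic `NumberTheory/EllipticCurves` (grouping namespace `CoatesSujatha2005`, next to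
`FineSelmerIsotypicClassGroupCriterion.lean`).  THEOREM-ONLY file (no definition, no named fact, no
`sorry`), written by the literature seat `bsd-potss-conjA-anchor` g18 (cell `bsd-potss`; serves the
asides stmt-BirchSwinnertonDyer-19386 / 19413; closes nothing; neither Conjecture A nor BSD is proved
for any particular curve here — the per-row inputs (c1), (c2)_{S,n+1}, (c3′)/(c3*) remain hypotheses).

THE STATEMENT («door L5» of the seat's generation g15, there a paper argument through Poitou–Tate and
`H²(ℚ_S/ℚ_n, E[p])`, recorded as «XL, WANT-level» for the tree; here a KERNEL THEOREM by the `H²`-free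
descent road of generations g16–g17).  `K` a number field, `p` odd, `K_∞/K` a `ℤ_p`-extension with ONE
place `v₀` above `p`, totally ramified; `L₀/K` finite Galois with `p ∤ [L₀ : K]`, `L_m = L₀K_m`; `M` finite,
`pM = 0`, `Γ_{L₀}` acting trivially.  Fix `n`.  Let `S` consist of the place `v₀` and of «bad» places `u`,
each with (c3′) `κ(D_u ∩ Γ_{L₀}) ⊄ p^{n+1}ℤ_p` (⟺ the residue degree of `L_{n+1}/L₀` at the chosen prime
above `u` is `≥ p`; for `K = ℚ`, `κ` cyclotomic, `u = q ≠ p` unramified in `L₀`: `q` not completely split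
in `ℚ_{n+1}`, i.e. `q^{p-1} ≢ 1 mod p^{n+2}`) or (c3*) `M^{D_u} = 0`.  IF
`Hom_{Γ_K}(Cl(𝓞_{L_{n+1}})/⟨classes of the primes above S⟩, M) = 0`, THEN `Sel₀(K_∞, M)` is finite — for
`M = E[p]` over `ℚ_cyc` this is Coates–Sujatha's Conjecture A (file `FineSelmerLayerCriterionRat`).  The
point: NO condition at the primes above `p` (at layers `≥ 1` the norm/total ramification makes them
harmless — g15 memo §2.3), so the criterion serves the cell's ♯ rows (`E(ℚ_p)[p] ≠ 0`), where
Deo–Ray–Sujatha's Thm. 3.8 is void at every layer.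

* `finite_fineSelmerInfty_of_equivariantHom_classGroup_layer_eq_zero` — the theorem above.

## References

* J. Coates, R. Sujatha, *Fine Selmer groups of elliptic curves over p-adic Lie extensions*, Math. Ann.
  331 (2005), §3 Thm. 3.4, Lemma 3.8. [CoatesSujatha2005]
* S. V. Deo, A. Ray, R. Sujatha, Pure Appl. Math. Q. 19 (2023), §3 Thm. 3.8, definition of `H′_L`
  (arXiv:2202.09937 p. 9). [DeoRaySujatha2023]
* A. Ray, R. Sujatha, arXiv:2508.17156 (2025), Cor. 3.7 (the layer-`n` form of DRS Lemma 3.6, with the FULL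
  vanishing of `H²(K_S/K_n)`; printed precedent for «criterion at a finite layer»). [RaySujatha2025]
* L. C. Washington, *Introduction to Cyclotomic Fields*, 2nd ed. (1997), §13.1, §13.3. [Washington1997]
* J. Neukirch, *Algebraic Number Theory* (1999), Ch. I §9, Ch. IV §6, Ch. VI. [NeukirchANT1999]
-/

noncomputable section

open scoped Classical Pointwise nonZeroDivisors
open NumberField Field IntermediateField IsDedekindDomain WeierstrassCurve
open Literature.NumberTheory.GaloisRepresentations Literature.NumberTheory.NumberFields
open Literature.NumberTheory.EllipticCurves Literature.NumberTheory.EllipticCurves.GreenbergSelmer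

namespace Literature.NumberTheory.EllipticCurves.CoatesSujatha2005

/-! ## §0 Helpers (copies of the private helpers of `FineSelmerIsotypicClassGroupCriterion.lean`, plus
conjugate decomposition groups and two facts about `ℤ_p`) -/

section Helpers

variable {K : Type} [Field K]

/-- `τ|_E = 1` iff `τ ∈ Gal(K̄/E)`. [folklore] -/
private theorem absRestrictNormalHom_eq_one_iff_mem_fixingSubgroupL5
    (E : IntermediateField K (AlgebraicClosure K)) [Normal K E] (τ : absoluteGaloisGroup K) :
    absRestrictNormalHom E τ = 1 ↔ absoluteGaloisGroup.toAlgEquiv K τ ∈ E.fixingSubgroup := by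
  have hc : ∀ x : E, ((absRestrictNormalHom E τ x : E) : AlgebraicClosure K) =
      τ • (x : AlgebraicClosure K) := fun x => AlgEquiv.restrictNormalHom_apply E _ x
  rw [IntermediateField.mem_fixingSubgroup_iff]
  constructor
  · intro h x hx
    change τ • x = x
    rw [← hc ⟨x, hx⟩, h, AlgEquiv.one_apply]
  · intro h
    ext x
    rw [hc x, AlgEquiv.one_apply]
    exact h x x.2

/-- `τ|_{E₁E₂} = 1 ↔ τ|_{E₁} = 1 ∧ τ|_{E₂} = 1`. [folklore] -/
private theorem absRestrictNormalHom_sup_eq_one_iffL5 (E₁ E₂ : IntermediateField K (AlgebraicClosure K))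
    [Normal K E₁] [Normal K E₂] (τ : absoluteGaloisGroup K) :
    absRestrictNormalHom (E₁ ⊔ E₂ : IntermediateField K (AlgebraicClosure K)) τ = 1 ↔
      absRestrictNormalHom E₁ τ = 1 ∧ absRestrictNormalHom E₂ τ = 1 := by
  rw [absRestrictNormalHom_eq_one_iff_mem_fixingSubgroupL5,
    absRestrictNormalHom_eq_one_iff_mem_fixingSubgroupL5,
    absRestrictNormalHom_eq_one_iff_mem_fixingSubgroupL5, IntermediateField.fixingSubgroup_sup,
    Subgroup.mem_inf]

/-- The kernel of `Γ_K → Gal(E/K)` is open for `E/K` finite. [folklore] -/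
private theorem isOpen_ker_absRestrictNormalHomL5 (E : IntermediateField K (AlgebraicClosure K))
    [FiniteDimensional K E] [Normal K E] :
    IsOpen ((absRestrictNormalHom E).ker : Set (absoluteGaloisGroup K)) := by
  have h : ((absRestrictNormalHom E).ker : Set (absoluteGaloisGroup K)) =
      (absoluteGaloisGroup.toAlgEquiv K) ⁻¹'
        (E.fixingSubgroup : Set (AlgebraicClosure K ≃ₐ[K] AlgebraicClosure K)) := by
    ext γ
    rw [SetLike.mem_coe, MonoidHom.mem_ker, absRestrictNormalHom_eq_one_iff_mem_fixingSubgroupL5,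
      Set.mem_preimage, SetLike.mem_coe]
  rw [h]
  exact E.fixingSubgroup_isOpen.preimage continuous_id

variable {p : ℕ} [Fact p.Prime]

/-- Decomposition groups of conjugate primes are conjugate: `x ∈ D_{γ𝔓} ↔ γ⁻¹xγ ∈ D_𝔓`. [folklore] -/
private theorem mem_stabilizer_smul_iffL5 {A : Type*} [Ring A] {G : Type*} [Group G]
    [MulSemiringAction G A] (γ : G) (𝔓 : Ideal A) (x : G) :
    x ∈ MulAction.stabilizer G (γ • 𝔓) ↔ γ⁻¹ * x * γ ∈ MulAction.stabilizer G 𝔓 := by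
  rw [MulAction.stabilizer_smul_eq_stabilizer_map_conj, Subgroup.mem_map_equiv, MulAut.conj_symm_apply]

/-- Restriction `Γ_K → Gal(E/K)` is onto. [folklore] -/
private theorem absRestrictNormalHom_surjectiveL5 (E : IntermediateField K (AlgebraicClosure K))
    [Normal K E] : Function.Surjective (absRestrictNormalHom E) := fun g => by
  obtain ⟨σ, hσ⟩ := AlgEquiv.restrictNormalHom_surjective (AlgebraicClosure K) g
  exact ⟨(Field.absoluteGaloisGroup.toAlgEquiv K).symm σ, hσ⟩

/-- A closed subset of `ℤ_p` containing all natural multiples of `x` contains all `ℤ_p`-multiples of `x`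
(`ℕ` is dense in `ℤ_p`). [folklore] -/
private theorem padicInt_mul_mem_of_isClosedL5 {S : Set ℤ_[p]} (hS : IsClosed S) {x : ℤ_[p]}
    (hx : ∀ m : ℕ, (m : ℤ_[p]) * x ∈ S) (c : ℤ_[p]) : c * x ∈ S := by
  have hcl : IsClosed ((fun c : ℤ_[p] => c * x) ⁻¹' S) := hS.preimage (continuous_id.mul continuous_const)
  have hsub : Set.range (Nat.cast : ℕ → ℤ_[p]) ⊆ (fun c : ℤ_[p] => c * x) ⁻¹' S := by
    rintro _ ⟨m, rfl⟩
    exact hx m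
  have huniv : (fun c : ℤ_[p] => c * x) ⁻¹' S = Set.univ := by
    apply Set.eq_univ_of_univ_subset
    rw [← PadicInt.denseRange_natCast.closure_range]
    exact hcl.closure_subset_iff.mpr hsub
  have hc : c ∈ (fun c : ℤ_[p] => c * x) ⁻¹' S := by rw [huniv]; trivial
  exact hc

/-- In `ℤ_p`: if `p^{n+1} ∤ x` and `pⁿ ∣ t` then `t` is a multiple of `x`. [folklore] -/
private theorem padicInt_exists_mul_eqL5 {x t : ℤ_[p]} {n : ℕ}
    (hx : ¬ (p : ℤ_[p]) ^ (n + 1) ∣ x) (ht : (p : ℤ_[p]) ^ n ∣ t) : ∃ c : ℤ_[p], c * x = t := by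
  have hx0 : x ≠ 0 := by
    rintro rfl
    exact hx (dvd_zero _)
  have hv : x.valuation ≤ n := by
    by_contra h
    apply hx
    have h' : n + 1 ≤ x.valuation := by omega
    exact Ideal.mem_span_singleton.mp ((PadicInt.mem_span_pow_iff_le_valuation x hx0 (n + 1)).mpr h')
  obtain ⟨r, rfl⟩ := ht
  have hxu := PadicInt.unitCoeff_spec hx0
  set u : ℤ_[p]ˣ := PadicInt.unitCoeff hx0 with hudef
  set v : ℕ := x.valuation with hvdef
  refine ⟨((u⁻¹ : ℤ_[p]ˣ) : ℤ_[p]) * (p : ℤ_[p]) ^ (n - v) * r, ?_⟩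
  calc ((u⁻¹ : ℤ_[p]ˣ) : ℤ_[p]) * (p : ℤ_[p]) ^ (n - v) * r * x
      = ((u⁻¹ : ℤ_[p]ˣ) : ℤ_[p]) * (p : ℤ_[p]) ^ (n - v) * r * ((u : ℤ_[p]) * (p : ℤ_[p]) ^ v) :=
        congrArg (fun y => ((u⁻¹ : ℤ_[p]ˣ) : ℤ_[p]) * (p : ℤ_[p]) ^ (n - v) * r * y) hxu
    _ = (((u⁻¹ : ℤ_[p]ˣ) : ℤ_[p]) * (u : ℤ_[p])) * ((p : ℤ_[p]) ^ (n - v) * (p : ℤ_[p]) ^ v) * r := by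
        ring
    _ = (p : ℤ_[p]) ^ n * r := by
        rw [Units.inv_mul, one_mul, ← pow_add, Nat.sub_add_cancel hv]



/-- `g|_{K_m} = 1 ↔ g ∈ κ⁻¹(pᵐℤ_p)`. [folklore] -/
private theorem absRestrictNormalHom_layer_eq_one_iffL5 [PerfectField K] (κ : ZpExtension K p)
    (m : ℕ) [Normal K (κ.layer m)] (g : absoluteGaloisGroup K) :
    absRestrictNormalHom (κ.layer m) g = 1 ↔ g ∈ κ.layerSubgroup m := by
  rw [absRestrictNormalHom_eq_one_iff_mem_fixingSubgroupL5, κ.fixingSubgroup_layer m]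
  constructor
  · rintro ⟨g', hg', hgg'⟩
    have : g' = g := (absoluteGaloisGroup.toAlgEquiv K).injective hgg'
    exact this ▸ hg'
  · exact fun h => ⟨g, h, rfl⟩

/-- Inertia groups of conjugate primes are conjugate: `I_{γ𝔓} = γ I_𝔓 γ⁻¹`. [folklore] -/
private theorem inertia_smul_eq_map_conjL5 (γ : absoluteGaloisGroup K)
    (𝔓 : Ideal (absIntegers (𝓞 K) K)) :
    (γ • 𝔓).inertia (absoluteGaloisGroup K) =
      (𝔓.inertia (absoluteGaloisGroup K)).map (MulAut.conj γ).toMonoidHom := by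
  ext σ
  rw [Subgroup.mem_map_equiv, Ideal.inertia, Ideal.inertia, AddSubgroup.mem_inertia,
    AddSubgroup.mem_inertia, MulAut.conj_symm_apply]
  constructor
  · intro h x
    have h1 := h (γ • x)
    rw [Submodule.mem_toAddSubgroup, Ideal.mem_pointwise_smul_iff_inv_smul_mem, smul_sub,
      inv_smul_smul, smul_smul, smul_smul] at h1
    exact h1
  · intro h x
    have h1 := h (γ⁻¹ • x)
    rw [Submodule.mem_toAddSubgroup, Ideal.mem_pointwise_smul_iff_inv_smul_mem, smul_sub,
      smul_smul]
    rwa [smul_smul, mul_inv_cancel_right, Submodule.mem_toAddSubgroup] at h1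

/-- `x ∈ I_{γ𝔓} ↔ γ⁻¹xγ ∈ I_𝔓`. [folklore] -/
private theorem mem_inertia_smul_iffL5 (γ : absoluteGaloisGroup K) (𝔓 : Ideal (absIntegers (𝓞 K) K))
    (x : absoluteGaloisGroup K) :
    x ∈ (γ • 𝔓).inertia (absoluteGaloisGroup K) ↔ γ⁻¹ * x * γ ∈ 𝔓.inertia (absoluteGaloisGroup K) := by
  rw [inertia_smul_eq_map_conjL5, Subgroup.mem_map_equiv, MulAut.conj_symm_apply]

/-- Conjugates of a prime above `v` lie above `v`. [folklore] -/
private theorem smul_mem_primesAboveL5 {v : HeightOneSpectrum (𝓞 K)} {𝔓 : Ideal (absIntegers (𝓞 K) K)}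
    (h𝔓 : 𝔓 ∈ v.primesAbove) (σ : absoluteGaloisGroup K) : σ • 𝔓 ∈ v.primesAbove := by
  obtain ⟨hprime, hover⟩ := HeightOneSpectrum.mem_primesAbove_iff.mp h𝔓
  haveI := hprime
  refine HeightOneSpectrum.mem_primesAbove_iff.mpr ⟨Ideal.IsPrime.smul _, ⟨?_⟩⟩
  rw [Ideal.under_smul]
  exact hover.over

variable [NumberField K]

/-- A maximal ideal of `ℤ̄_K` lies above the finite place `𝔓 ∩ 𝓞 K` of `K`. [folklore] -/
private theorem exists_mem_primesAbove_of_isMaximalL5 (𝔓 : Ideal (absIntegers (𝓞 K) K))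
    [h𝔓 : 𝔓.IsMaximal] : ∃ v : HeightOneSpectrum (𝓞 K), 𝔓 ∈ v.primesAbove := by
  haveI : (𝔓.under (𝓞 K)).IsMaximal := Ideal.IsMaximal.under (𝓞 K) 𝔓
  have hne : 𝔓.under (𝓞 K) ≠ ⊥ := Ring.ne_bot_of_isMaximal_of_not_isField inferInstance
    (RingOfIntegers.not_isField K)
  exact ⟨⟨𝔓.under (𝓞 K), Ideal.IsMaximal.isPrime inferInstance, hne⟩,
    HeightOneSpectrum.mem_primesAbove_iff.mpr ⟨h𝔓.isPrime, ⟨rfl⟩⟩⟩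

end Helpers

/-! ## §1 Door L5, general form -/

section General

variable {K : Type} [Field K] [NumberField K] {p : ℕ} [Fact p.Prime]

set_option maxHeartbeats 1600000 in
set_option synthInstance.maxHeartbeats 200000 in
/-- **DOOR L5 (general form): the `S`-split `E[p]`-part of the class group of ONE layer `L₀K_{n+1}`
vanishes ⟹ `Sel₀(K_∞, M)` is finite — with NO local condition at the primes above `p`.**
`K` a number field, `p` odd, `κ` a `ℤ_p`-extension of `K` with layers `K_m` (finite Galois over `K`),
`L₀ ⊆ K̄` finite Galois with `p ∤ [L₀ : K]`, `L_m = L₀K_m` number fields; `M` a finite discrete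
`Γ_K`-module with `pM = 0` fixed pointwise by `Γ_{L₀}`; `v₀` the ONLY place of `K` above `p`, `𝔓₀ ∣ v₀`
totally ramified in `K_∞/K` (`I_{𝔓₀}·Gal(K̄/K_∞) = Γ_K`); `n : ℕ`; `bad` a set of finite places `u` of `K`
each satisfying EITHER (c3′) some `σ ∈ D_u ∩ Γ_{L₀}` has `κ(σ) ∉ p^{n+1}ℤ_p` (the prime of `L₀` under the
chosen prime above `u` does NOT split completely in `L_{n+1}/L₀`), OR (c3*) `M^{D_u} = 0`.  IF every
additive `Γ_K`-equivariant `f : Cl(𝓞_{L_{n+1}}) → M` killing the classes of the primes of `L_{n+1}` above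
`p` and above the bad places is zero, THEN the fine Selmer group `Sel₀(K_∞, M)`
(`GreenbergSelmer.fineSelmerInfty M κ`) is finite.  PROOF (H²-free; the seat's «door L5» of g15 made a
theorem): if `Sel₀` is infinite, a non-zero `Γ_K`-invariant shadow `φ` on `H′ = Gal(K̄/L₀K_∞)`
(`FineSelmerResidualCharacter*`) extends ONE LAYER UP to `ψ` on `Λ_{n+1} = Gal(K̄/L_{n+1})`, additive,
equivariant, killing all inertia groups (`EquivariantUnramifiedDescent`; total ramification from level
`0` by `forall_exists_mem_of_not_dvd_index`); `ψ` ALSO kills the decomposition groups `D_𝔮 ∩ Λ_{n+1}` at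
the primes above `p` (total ramification + fineness of `φ` at `v₀`) and at the (c3′)-places (the image
`κ(D_u ∩ Γ_{L₀})` is a closed subgroup of `ℤ_p` not inside `p^{n+1}ℤ_p`, so `⊇ pⁿℤ_p`; fineness of `φ` at
`u`; `mem_descentSubgroup_of_forall_exists`); then equivariant Artin reciprocity with `S`-split base,
decomposition/(c3*) form (`forall_eq_zero_of_forall_equivariantHom_classGroup_eq_zero_of_decomposition`)
makes `ψ = 0` on `Λ_{n+1}`, contradicting `φ ≠ 0`.
[cite: CoatesSujatha2005, §3 Thm. 3.4 (proof) and Lemma 3.8]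
[cite: Washington1997, §13.1 Lemma 13.3, §13.3 Lemmas 13.14–13.15 and Thm. 10.4 (proof)]
[cite: DeoRaySujatha2023, §3 Thm. 3.8 (c2), (c3) and the definition of H′_L (arXiv:2202.09937 p. 9)]
[cite: NeukirchANT1999, Ch. I §9 (9.1), (9.4)–(9.6)] -/
theorem finite_fineSelmerInfty_of_equivariantHom_classGroup_layer_eq_zero (hp2 : p ≠ 2)
    (κ : ZpExtension K p) (L₀ : IntermediateField K (AlgebraicClosure K)) [FiniteDimensional K L₀]
    [IsGalois K L₀] (hL₀ : ¬ p ∣ Module.finrank K L₀)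
    [∀ n, FiniteDimensional K (κ.layer n)] [∀ n, IsGalois K (κ.layer n)]
    [hNF : ∀ m, NumberField (L₀ ⊔ κ.layer m : IntermediateField K (AlgebraicClosure K))]
    {M : Type} [AddCommGroup M] [DistribMulAction (absoluteGaloisGroup K) M] [TopologicalSpace M]
    [DiscreteTopology M] [Finite M] (hpM : ∀ m : M, p • m = 0)
    (htriv : ∀ σ : absoluteGaloisGroup K, absRestrictNormalHom L₀ σ = 1 → ∀ m : M, σ • m = m)
    (v₀ : HeightOneSpectrum (𝓞 K)) (hv₀ : ((p : ℕ) : 𝓞 K) ∈ v₀.asIdeal)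
    (huniq : ∀ v : HeightOneSpectrum (𝓞 K), ((p : ℕ) : 𝓞 K) ∈ v.asIdeal → v = v₀)
    {𝔓₀ : Ideal (absIntegers (𝓞 K) K)} (h𝔓₀ : 𝔓₀ ∈ v₀.primesAbove)
    (hram : 𝔓₀.inertia (absoluteGaloisGroup K) ⊔ κ.kerSubgroup = ⊤)
    (n : ℕ) (bad : HeightOneSpectrum (𝓞 K) → Prop)
    (hbad : ∀ u : HeightOneSpectrum (𝓞 K), bad u →
      (∃ σ ∈ GreenbergSelmer.decomp u, absRestrictNormalHom L₀ σ = 1 ∧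
          ¬ (p : ℤ_[p]) ^ (n + 1) ∣ (κ σ).toAdd) ∨
      (∀ x : M, (∀ d ∈ GreenbergSelmer.decomp u, d • x = x) → x = 0))
    (hL5 : ∀ (f : Additive (ClassGroup (𝓞 (L₀ ⊔ κ.layer (n + 1) : IntermediateField K (AlgebraicClosure K))))
        →+ M),
      (∀ (τ : absoluteGaloisGroup K)
          (c : ClassGroup (𝓞 (L₀ ⊔ κ.layer (n + 1) : IntermediateField K (AlgebraicClosure K)))),
        f (Additive.ofMul (ClassGroup.mulEquiv (AmbiguousClass.intAut
          (absRestrictNormalHom (L₀ ⊔ κ.layer (n + 1) : IntermediateField K (AlgebraicClosure K)) τ))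
            c)) = τ • f (Additive.ofMul c)) →
      (∀ (w : HeightOneSpectrum (𝓞 (L₀ ⊔ κ.layer (n + 1) : IntermediateField K (AlgebraicClosure K))))
          (u : HeightOneSpectrum (𝓞 K)), (((p : ℕ) : 𝓞 K) ∈ u.asIdeal ∨ bad u) →
        w.asIdeal.under (𝓞 K) = u.asIdeal →
        f (Additive.ofMul (ClassGroup.mk0 ⟨w.asIdeal, mem_nonZeroDivisors_of_ne_zero w.ne_bot⟩)) = 0) →
      f = 0) :
    (fineSelmerInfty M κ : Set (subgroupH1 κ.kerSubgroup M)).Finite := by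
  classical
  by_contra hinf
  change (fineSelmerInfty M κ : Set (subgroupH1 κ.kerSubgroup M)).Infinite at hinf
  have hp : p.Prime := Fact.out
  haveI := absoluteGaloisGroup_compactSpace K
  -- ### `Λ₀ = Γ_{L₀}`
  set Λ₀ : Subgroup (absoluteGaloisGroup K) := (absRestrictNormalHom L₀).ker with hΛ₀def
  have hmemΛ₀ : ∀ σ, σ ∈ Λ₀ ↔ absRestrictNormalHom L₀ σ = 1 := fun σ => MonoidHom.mem_ker
  haveI hΛ₀n : Λ₀.Normal := by rw [hΛ₀def]; infer_instance
  have hΛ₀open : IsOpen (Λ₀ : Set (absoluteGaloisGroup K)) := by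
    rw [hΛ₀def]; exact isOpen_ker_absRestrictNormalHomL5 L₀
  haveI : Λ₀.FiniteIndex := by
    haveI := Subgroup.quotient_finite_of_isOpen Λ₀ hΛ₀open
    exact Subgroup.finiteIndex_of_finite_quotient
  have htrivΛ₀ : ∀ σ ∈ Λ₀, ∀ m : M, σ • m = m := fun σ hσ => htriv σ ((hmemΛ₀ σ).1 hσ)
  -- ### (1) the invariant non-zero shadow
  obtain ⟨f, z, hzS, hfz, hf, hne, hinv⟩ :=
    FineSelmerResidualCharacter.exists_invariant_shadow κ Λ₀ hΛ₀open hpM htrivΛ₀ hinf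
  -- ### data for the descent
  set κ' : absoluteGaloisGroup K →* Multiplicative ℤ_[p] := κ.toContinuousMonoidHom.toMonoidHom
    with hκ'def
  have hκ' : ∀ σ, κ' σ = κ σ := fun _ => rfl
  set H' : Subgroup (absoluteGaloisGroup K) := Λ₀ ⊓ κ.kerSubgroup with hH'def
  have hH' : ∀ σ, σ ∈ H' ↔ σ ∈ Λ₀ ∧ κ' σ = 1 := fun σ => by
    rw [hH'def, Subgroup.mem_inf, ZpExtension.mem_kerSubgroup, hκ']
  let Λ : ℕ → Subgroup (absoluteGaloisGroup K) := fun m => Λ₀ ⊓ κ.layerSubgroup m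
  have hΛinf : ∀ m, Λ m = Λ₀ ⊓ κ.layerSubgroup m := fun _ => rfl
  have hΛ : ∀ m σ, σ ∈ Λ m ↔ σ ∈ Λ₀ ∧ (p : ℤ_[p]) ^ m ∣ (κ' σ).toAdd := fun m σ => by
    rw [hΛinf, Subgroup.mem_inf, ZpExtension.mem_layerSubgroup, hκ']
  -- primes of `ℤ̄_K` together with the place below
  let ι := {x : HeightOneSpectrum (𝓞 K) × Ideal (absIntegers (𝓞 K) K) // x.2 ∈ x.1.primesAbove}
  let I : ι → Subgroup (absoluteGaloisGroup K) := fun i => i.1.2.inertia (absoluteGaloisGroup K)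
  have hIdef : ∀ i, I i = i.1.2.inertia (absoluteGaloisGroup K) := fun _ => rfl
  let pAdic : ι → Prop := fun i => ((p : ℕ) : 𝓞 K) ∈ i.1.1.asIdeal
  have hpAdic : ∀ i, pAdic i ↔ ((p : ℕ) : 𝓞 K) ∈ i.1.1.asIdeal := fun _ => Iff.rfl
  let i₀ : ι := ⟨(v₀, 𝔓₀), h𝔓₀⟩
  have hi₀ : pAdic i₀ := hv₀
  have hconj : ∀ g : absoluteGaloisGroup K, ∃ j, pAdic j ∧ ∀ x, x ∈ I j ↔ g⁻¹ * x * g ∈ I i₀ :=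
    fun g => ⟨⟨(v₀, g • 𝔓₀), smul_mem_primesAboveL5 h𝔓₀ g⟩, hv₀, fun x => mem_inertia_smul_iffL5 g 𝔓₀ x⟩
  have hIker : ∀ i, ¬ pAdic i → ∀ x ∈ I i, κ' x = 1 := by
    intro i hi x hx
    exact ZpExtension.mem_kerSubgroup.1 (ZpExtension.inertia_le_kerSubgroup_holds K p κ hi i.2 hx)
  have htrans : ∀ i, pAdic i → ∃ g : absoluteGaloisGroup K, ∀ x, x ∈ I i ↔ g⁻¹ * x * g ∈ I i₀ := by
    intro i hi
    have hv : i.1.1 = v₀ := huniq _ hi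
    have h𝔓 : i.1.2 ∈ v₀.primesAbove := hv ▸ i.2
    obtain ⟨γ, hγ⟩ := HeightOneSpectrum.exists_smul_eq_of_mem_primesAbove_holds h𝔓₀ h𝔓
    refine ⟨γ, fun x => ?_⟩
    rw [hIdef, hIdef, ← hγ]
    exact mem_inertia_smul_iffL5 γ 𝔓₀ x
  have hsurj : ∀ t : ℤ_[p], ∃ y ∈ I i₀, (κ' y).toAdd = t := by
    intro t
    obtain ⟨γ, hγ⟩ := κ.surjective (Multiplicative.ofAdd t)
    rw [ZpExtension.coe_toContinuousMonoidHom] at hγ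
    haveI : κ.kerSubgroup.Normal := by
      change (κ.toContinuousMonoidHom.toMonoidHom.ker).Normal
      infer_instance
    have hγmem : γ ∈ ((𝔓₀.inertia (absoluteGaloisGroup K) ⊔ κ.kerSubgroup :
        Subgroup (absoluteGaloisGroup K)) : Set (absoluteGaloisGroup K)) := by
      rw [hram]; trivial
    rw [Subgroup.mul_normal] at hγmem
    obtain ⟨i, hi, n, hn, rfl⟩ := Set.mem_mul.mp hγmem
    refine ⟨i, hi, ?_⟩
    have hn1 : κ n = 1 := ZpExtension.mem_kerSubgroup.mp hn
    rw [map_mul, hn1, mul_one] at hγ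
    rw [hκ', hγ]
    rfl
  -- ### total ramification from level `0` (`p ∤ [L₀ : K]`)
  have hidx : ¬ p ∣ Λ₀.index := by
    rw [hΛ₀def, Subgroup.index_ker, MonoidHom.range_eq_top_of_surjective _
      (absRestrictNormalHom_surjectiveL5 L₀), Subgroup.card_top, IsGalois.card_aut_eq_finrank]
    exact hL₀
  have hramAll := EquivariantUnramifiedDescent.forall_exists_mem_of_not_dvd_index κ' Λ₀ hidx I pAdic
    i₀ htrans hsurj
  -- conjugation stability of `Λ (n + 1)`
  have hκconj : ∀ g x : absoluteGaloisGroup K, κ' (g * x * g⁻¹) = κ' x := fun g x => by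
    rw [map_mul, map_mul, map_inv, mul_comm (κ' g) (κ' x), mul_assoc, mul_inv_cancel, mul_one]
  have hΛn : ∀ (g : absoluteGaloisGroup K), ∀ x ∈ Λ (n + 1), g * x * g⁻¹ ∈ Λ (n + 1) := fun g x hx => by
    rw [hΛ] at hx ⊢
    exact ⟨hΛ₀n.conj_mem x hx.1 g, by rw [hκconj]; exact hx.2⟩
  -- ### the hypotheses on the shadow `φ = f`
  have hφ_mul : ∀ a ∈ H', ∀ b ∈ H', f (a * b) = f a + f b := fun a ha b hb =>
    FineSelmerResidualCharacter.shadow_mul κ Λ₀ htrivΛ₀ f z hfz ha hb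
  have hφ_equiv : ∀ (g : absoluteGaloisGroup K), ∀ τ ∈ H', f (g * τ * g⁻¹) = g • f τ := by
    intro g τ _
    have h : g • f (g⁻¹ * (g * τ * g⁻¹) * g) = f (g * τ * g⁻¹) := congr_fun (hinv g) (g * τ * g⁻¹)
    rw [← h]
    have e1 : g⁻¹ * (g * τ * g⁻¹) * g = τ := by group
    rw [e1]
  have hφ_I : ∀ i, ∀ τ ∈ I i, τ ∈ H' → f τ = 0 := by
    rintro ⟨⟨v, 𝔓⟩, h𝔓⟩ τ hτ hτH
    obtain ⟨γ, hγ⟩ := HeightOneSpectrum.exists_smul_eq_of_mem_primesAbove_holds h𝔓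
      (adicCompletionPrime_mem_primesAbove K v)
    refine FineSelmerResidualCharacter.shadow_eq_zero_of_conj_mem_decomp κ Λ₀ htrivΛ₀ f z hzS hfz v
      γ⁻¹ (by rw [hH'def] at hτH; exact hτH) ?_
    rw [inv_inv]
    have h1 : γ * τ * γ⁻¹ ∈ (adicCompletionPrime K v).inertia (absoluteGaloisGroup K) := by
      rw [← hγ, mem_inertia_smul_iffL5]
      have e1 : γ⁻¹ * (γ * τ * γ⁻¹) * γ = τ := by group
      rw [e1]
      exact hτ
    have h2 := (Ideal.inertia_le_decompositionSubgroup (absoluteGaloisGroup K)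
      (adicCompletionPrime K v)) h1
    rw [decompositionSubgroup_adicCompletionPrime_eq_range K v] at h2
    exact h2
  -- ### (2) the equivariant unramified descent at the GIVEN level `n + 1`
  obtain ⟨Q, ψ, hQmem, hQle, hQconj, hψφ, hψmul, hψeq, hψI, hψker, -⟩ :=
    EquivariantUnramifiedDescent.exists_equivariant_unramified_extension κ' Λ₀ H' hH' Λ hΛ hpM
      htrivΛ₀ I pAdic i₀ hi₀ hconj hIker n (hramAll n) f hφ_mul hφ_equiv hφ_I
  haveI hQn : Q.Normal := ⟨fun x hx g => hQconj g x hx⟩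
  have hΛopen : IsOpen (Λ (n + 1) : Set (absoluteGaloisGroup K)) := by
    rw [hΛinf, Subgroup.coe_inf]
    exact hΛ₀open.inter (κ.isOpen_layerSubgroup (n + 1))
  haveI : (Λ (n + 1)).FiniteIndex := by
    haveI := Subgroup.quotient_finite_of_isOpen (Λ (n + 1)) hΛopen
    exact Subgroup.finiteIndex_of_finite_quotient
  -- `Q` is open
  have hQopen : IsOpen (Q : Set (absoluteGaloisGroup K)) := by
    refine EquivariantUnramifiedDescent.isOpen_of_eq_mul_of_ker Q (Λ (n + 1)) hQle
      ((I i₀ : Set (absoluteGaloisGroup K)) ∩ (Λ (n + 1) : Set (absoluteGaloisGroup K)))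
      {k | k ∈ H' ∧ f k = 0} ?_ ?_ ?_ ψ hψmul hψker
    · refine IsClosed.isCompact (IsClosed.inter ?_ (Subgroup.isClosed_of_isOpen _ hΛopen))
      exact absIntegers.isClosed_inertia_holds (R := 𝓞 K) (K := K) 𝔓₀
    · have hcl : IsClosed {τ : κ.kerSubgroup | (τ : absoluteGaloisGroup K) ∈ Λ₀ ∧ z.1 τ = 0} := by
        refine IsClosed.inter ?_ ?_
        · exact (Subgroup.isClosed_of_isOpen _ hΛ₀open).preimage continuous_subtype_val
        · exact (isClosed_discrete {(0 : M)}).preimage z.1.continuous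
      have himg : {k : absoluteGaloisGroup K | k ∈ H' ∧ f k = 0} =
          Subtype.val '' {τ : κ.kerSubgroup | (τ : absoluteGaloisGroup K) ∈ Λ₀ ∧ z.1 τ = 0} := by
        ext k
        constructor
        · rintro ⟨hkH, hk0⟩
          rw [hH'def] at hkH
          obtain ⟨hkΛ, hkker⟩ := Subgroup.mem_inf.1 hkH
          refine ⟨⟨k, hkker⟩, ⟨hkΛ, ?_⟩, rfl⟩
          rw [← hfz ⟨k, hkker⟩ hkΛ]
          exact hk0
        · rintro ⟨τ, ⟨hτΛ, hτ0⟩, rfl⟩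
          refine ⟨?_, ?_⟩
          · rw [hH'def]; exact Subgroup.mem_inf.2 ⟨hτΛ, τ.2⟩
          · rw [hfz τ hτΛ]
            exact hτ0
      rw [himg]
      exact κ.isClosed_kerSubgroup.isClosedEmbedding_subtypeVal.isClosedMap _ hcl
    · ext x
      rw [SetLike.mem_coe, hQmem, Set.mem_mul]
      constructor
      · rintro ⟨y, hyI, k, hkH, hyΛ, hk0, rfl⟩
        exact ⟨y, ⟨hyI, hyΛ⟩, k, ⟨hkH, hk0⟩, rfl⟩
      · rintro ⟨y, ⟨hyI, hyΛ⟩, k, ⟨hkH, hk0⟩, rfl⟩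
        exact ⟨y, hyI, k, hkH, hyΛ, hk0, rfl⟩
  -- ### (3) class field theory at the layer `L₀K_{e+1}`
  have hΛ' : ∀ σ, σ ∈ Λ (n + 1) ↔
      absRestrictNormalHom (L₀ ⊔ κ.layer (n + 1) : IntermediateField K (AlgebraicClosure K)) σ = 1 := by
    intro σ
    rw [hΛinf, Subgroup.mem_inf, absRestrictNormalHom_sup_eq_one_iffL5,
      absRestrictNormalHom_layer_eq_one_iffL5, hmemΛ₀]
  have hψI' : ∀ (𝔓 : Ideal (absIntegers (𝓞 K) K)), 𝔓.IsMaximal →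
      ∀ σ ∈ 𝔓.inertia (absoluteGaloisGroup K), σ ∈ Λ (n + 1) → ψ σ = 0 := by
    intro 𝔓 h𝔓 σ hσ hσΛ
    haveI := h𝔓
    obtain ⟨v, hv⟩ := exists_mem_primesAbove_of_isMaximalL5 𝔓
    exact hψI ⟨(v, 𝔓), hv⟩ σ hσ hσΛ
  -- ### (3′) the descent subgroup swallows the decomposition groups (door L5)
  have hkill : ∀ (D : Subgroup (absoluteGaloisGroup K)),
      (∀ t : ℤ_[p], (p : ℤ_[p]) ^ n ∣ t → ∃ y ∈ D, y ∈ Λ₀ ∧ (κ' y).toAdd = t) →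
      (∀ τ ∈ D, τ ∈ H' → f τ = 0) → ∀ σ ∈ D, σ ∈ Λ (n + 1) → ψ σ = 0 :=
    fun D hD hfD σ hσD hσΛ => (hψker σ hσΛ).2
      (EquivariantUnramifiedDescent.mem_descentSubgroup_of_forall_exists κ' Λ₀ H' hH' Λ hΛ hpM htrivΛ₀
        (I i₀) n (hramAll n i₀ hi₀) f hφ_mul hφ_equiv Q hQmem D hD hfD σ hσD hσΛ)
  -- (T) at the primes above `p`: total ramification + fineness at `v₀`
  have hTp : ∀ 𝔮 ∈ v₀.primesAbove, ∀ σ ∈ MulAction.stabilizer (absoluteGaloisGroup K) 𝔮,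
      σ ∈ Λ (n + 1) → ψ σ = 0 := by
    intro 𝔮 h𝔮 σ hσ hσΛ
    refine hkill (MulAction.stabilizer (absoluteGaloisGroup K) 𝔮) ?_ ?_ σ hσ hσΛ
    · intro t ht
      obtain ⟨y, hyI, hyΛ₀, hyt⟩ := hramAll n ⟨(v₀, 𝔮), h𝔮⟩ hv₀ t ht
      exact ⟨y, (Ideal.inertia_le_decompositionSubgroup (absoluteGaloisGroup K) 𝔮) hyI, hyΛ₀, hyt⟩
    · intro τ hτD hτH
      obtain ⟨γ, hγ⟩ := HeightOneSpectrum.exists_smul_eq_of_mem_primesAbove_holds h𝔮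
        (adicCompletionPrime_mem_primesAbove K v₀)
      refine FineSelmerResidualCharacter.shadow_eq_zero_of_conj_mem_decomp κ Λ₀ htrivΛ₀ f z hzS hfz v₀
        γ⁻¹ (by rw [hH'def] at hτH; exact hτH) ?_
      rw [inv_inv]
      have h1 : γ * τ * γ⁻¹ ∈ (adicCompletionPrime K v₀).decompositionSubgroup (absoluteGaloisGroup K) := by
        rw [← hγ]
        refine (mem_stabilizer_smul_iffL5 γ 𝔮 _).mpr ?_
        have e1 : γ⁻¹ * (γ * τ * γ⁻¹) * γ = τ := by group
        rw [e1]
        exact hτD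
      rw [decompositionSubgroup_adicCompletionPrime_eq_range K v₀] at h1
      exact h1
  -- (T) at the bad places of type (c3′): `κ(D_u ∩ Λ₀) ⊄ p^{n+1}ℤ_p`
  have hTbad : ∀ u : HeightOneSpectrum (𝓞 K),
      (∃ σ ∈ GreenbergSelmer.decomp u, absRestrictNormalHom L₀ σ = 1 ∧
        ¬ (p : ℤ_[p]) ^ (n + 1) ∣ (κ σ).toAdd) →
      ∀ 𝔮 ∈ u.primesAbove, ∀ σ ∈ MulAction.stabilizer (absoluteGaloisGroup K) 𝔮,
        σ ∈ Λ (n + 1) → ψ σ = 0 := by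
    rintro u ⟨σ₁, hσ₁D, hσ₁L, hσ₁n⟩
    have hD₀eq : (adicCompletionPrime K u).decompositionSubgroup (absoluteGaloisGroup K) =
        GreenbergSelmer.decomp u := decompositionSubgroup_adicCompletionPrime_eq_range K u
    have hσ₁D' : σ₁ ∈ (adicCompletionPrime K u).decompositionSubgroup (absoluteGaloisGroup K) := by
      rw [hD₀eq]; exact hσ₁D
    have hσ₁Λ₀ : σ₁ ∈ Λ₀ := (hmemΛ₀ σ₁).2 hσ₁L
    have base : ∀ σ ∈ (adicCompletionPrime K u).decompositionSubgroup (absoluteGaloisGroup K),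
        σ ∈ Λ (n + 1) → ψ σ = 0 := by
      refine hkill _ ?_ ?_
      · -- `κ(D_u ∩ Λ₀)` is a closed subgroup of `ℤ_p` containing `κ σ₁`
        intro t ht
        set D₀ : Subgroup (absoluteGaloisGroup K) :=
          (adicCompletionPrime K u).decompositionSubgroup (absoluteGaloisGroup K) with hD₀def
        set S : Set ℤ_[p] :=
          (fun y : absoluteGaloisGroup K => (κ' y).toAdd) '' ((D₀ ⊓ Λ₀ : Subgroup (absoluteGaloisGroup K)) :
            Set (absoluteGaloisGroup K)) with hSdef
        have hcont : Continuous (fun y : absoluteGaloisGroup K => (κ' y).toAdd) :=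
          continuous_toAdd.comp κ.toContinuousMonoidHom.continuous
        have hcl : IsClosed ((D₀ ⊓ Λ₀ : Subgroup (absoluteGaloisGroup K)) : Set (absoluteGaloisGroup K)) := by
          rw [Subgroup.coe_inf]
          exact (absIntegers.isClosed_decompositionSubgroup_holds (R := 𝓞 K) (K := K)
            (adicCompletionPrime K u)).inter (Subgroup.isClosed_of_isOpen _ hΛ₀open)
        have hS : IsClosed S := (hcl.isCompact.image hcont).isClosed
        have hxS : ∀ m : ℕ, (m : ℤ_[p]) * (κ' σ₁).toAdd ∈ S := by
          intro m
          refine ⟨σ₁ ^ m, ?_, ?_⟩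
          · exact Subgroup.pow_mem _ (Subgroup.mem_inf.2 ⟨hσ₁D', hσ₁Λ₀⟩) m
          · change (κ' (σ₁ ^ m)).toAdd = (m : ℤ_[p]) * (κ' σ₁).toAdd
            rw [map_pow, toAdd_pow, nsmul_eq_mul]
        obtain ⟨c, hc⟩ := padicInt_exists_mul_eqL5 (x := (κ' σ₁).toAdd) hσ₁n ht
        have hmem := padicInt_mul_mem_of_isClosedL5 hS hxS c
        rw [hc] at hmem
        obtain ⟨y, hy, hyt⟩ := hmem
        exact ⟨y, (Subgroup.mem_inf.1 hy).1, (Subgroup.mem_inf.1 hy).2, hyt⟩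
      · intro τ hτD hτH
        refine FineSelmerResidualCharacter.shadow_eq_zero_of_conj_mem_decomp κ Λ₀ htrivΛ₀ f z hzS hfz u
          1 (by rw [hH'def] at hτH; exact hτH) ?_
        rw [inv_one, one_mul, mul_one, ← hD₀eq]
        exact hτD
    -- transport to every prime above `u` by conjugation (equivariance of `ψ`)
    intro 𝔮 h𝔮 σ hσ hσΛ
    obtain ⟨γ, hγ⟩ := HeightOneSpectrum.exists_smul_eq_of_mem_primesAbove_holds h𝔮
      (adicCompletionPrime_mem_primesAbove K u)
    have h1 : γ * σ * γ⁻¹ ∈ (adicCompletionPrime K u).decompositionSubgroup (absoluteGaloisGroup K) := by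
      rw [← hγ]
      refine (mem_stabilizer_smul_iffL5 γ 𝔮 _).mpr ?_
      have e1 : γ⁻¹ * (γ * σ * γ⁻¹) * γ = σ := by group
      rw [e1]
      exact hσ
    have h3 := base _ h1 (hΛn γ σ hσΛ)
    rw [hψeq γ σ hσΛ] at h3
    exact (smul_eq_zero_iff_eq γ).1 h3
  -- (C) at the bad places of type (c3*): `M^{D_𝔮} = 0` for every `𝔮 ∣ u`
  have hCbad : ∀ u : HeightOneSpectrum (𝓞 K),
      (∀ x : M, (∀ d ∈ GreenbergSelmer.decomp u, d • x = x) → x = 0) →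
      ∀ 𝔮 ∈ u.primesAbove, ∀ x : M,
        (∀ σ ∈ MulAction.stabilizer (absoluteGaloisGroup K) 𝔮, σ • x = x) → x = 0 := by
    intro u hC 𝔮 h𝔮 x hx
    obtain ⟨γ, hγ⟩ := HeightOneSpectrum.exists_smul_eq_of_mem_primesAbove_holds h𝔮
      (adicCompletionPrime_mem_primesAbove K u)
    have hγx : γ • x = 0 := by
      refine hC (γ • x) fun d hd => ?_
      have hd' : d ∈ (adicCompletionPrime K u).decompositionSubgroup (absoluteGaloisGroup K) := by
        rw [decompositionSubgroup_adicCompletionPrime_eq_range K u]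
        exact hd
      rw [← hγ] at hd'
      have hd'' := (mem_stabilizer_smul_iffL5 γ 𝔮 d).mp hd'
      have hfix := hx _ hd''
      conv_rhs => rw [← hfix]
      rw [smul_smul, smul_smul]
      congr 1
      group
    exact (smul_eq_zero_iff_eq γ).1 hγx
  have hzero :=
    EquivariantUnramifiedDescent.forall_eq_zero_of_forall_equivariantHom_classGroup_eq_zero_of_decomposition
      p hp2 (L₀ ⊔ κ.layer (n + 1) : IntermediateField K (AlgebraicClosure K)) (Λ (n + 1)) Q hΛ' hQopen
      hQle hpM ψ hψmul hψeq hψker hψI' (fun u => ((p : ℕ) : 𝓞 K) ∈ u.asIdeal ∨ bad u) (by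
        rintro u (hpu | hu)
        · left
          have huv : u = v₀ := huniq u hpu
          subst huv
          exact hTp
        · rcases hbad u hu with hT | hC
          · exact Or.inl (hTbad u hT)
          · exact Or.inr (hCbad u hC)) hL5
  -- ### contradiction: `f ≠ 0` but `ψ|_{H′} = f|_{H′}` vanishes
  apply hne
  funext τ
  rw [Pi.zero_apply]
  by_cases hτ : τ ∈ H'
  · have hτΛ : τ ∈ Λ (n + 1) := by
      rw [hΛ]
      refine ⟨((hH' τ).1 hτ).1, ?_⟩
      rw [((hH' τ).1 hτ).2, toAdd_one]
      exact dvd_zero _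
    rw [← hψφ τ hτ]
    exact hzero τ hτΛ
  · rw [hH'def] at hτ
    exact hf τ hτ


end General

end Literature.NumberTheory.EllipticCurves.CoatesSujatha2005

end
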